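import Mathlib
import Literature.NumberTheory.Sieve.Maynard2016CoupledEuler
import Literature.NumberTheory.Sieve.PolymathLcmSumsEuler
import HarnessLib

/-!
# Maynard (2016), Lemmas 6–7: the coupled Euler product with a general multiplicative weight

Topic `Literature/NumberTheory/Sieve`; trunk AntSieve / parity (Maynard 2016 large-gaps ladder, named
fact `Literature.NumberTheory.Sieve.Maynard2016.Lemma7Tuple` of `Maynard2016Lemma7PerTuple.lean`).

J. Maynard, *Large gaps between primes*, Ann. of Math. (2) 183 (2016), 915–933 = arXiv:1408.5110,
§6.  The main term of Lemma 6 ((6.10)–(6.13)) is the coupled sum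
`∑' (∏ g h)(∏ g' h')/lcm(∏_i [d_i,d'_i], ∏_j [e_j,e'_j])`, evaluated in `Maynard2016CoupledEuler`
(`sum_coupled_eq_prod`: `= ∏_p K_p`).  The main term of Lemma 7 (display (6.32)) is the SAME sum with
the denominator `lcm(…)` replaced by `φ(r)`, `r = lcm(…)` (`Maynard2016Lemma7RadLcm`,
`Maynard2016Lemma7CoupledLink`): "we can now evaluate the complete sums … in a manner essentially
identical to that of Lemma 6".  Following the one-sided weighted engine
`PolymathLcmSumsEuler.sum_pairBox_filter_eq_prod_weight` (Polymath 8b, Lemma 4.1, last paragraph: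
"the `1/p` term is replaced by `1/(p−1)`"), this file proves the coupled Euler product for a GENERAL
weight `w` multiplicative over products of distinct primes:

`∑_{(d,d') adm.} ∑_{(e,e') adm.} [CrossCond] (∏ g h)(∏ g' h') · w(lcm(∏ D, ∏ E))
   = ∏_{p ∈ P} ( 1 + w(p) [ ∑_i A_i(p) + [p ∤ m] ( ∑_j B_j(p) + ∑_{(i,j) ∈ M p} A_i(p) B_j(p) ) ] )`

(`sum_coupledW_eq_prod`; `w(n) = 1/n` recovers `coupledSummand` / `coupledLocalFactor`:
`coupledSummandW_inv`, `coupledLocalFactorW_inv`; `w = 1/φ` is Lemma 7's).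

## References

* J. Maynard, *Large gaps between primes*, Ann. of Math. (2) 183 (2016), 915–933; arXiv:1408.5110,
  §6, displays (6.10)–(6.13) and (6.32). [Maynard2016LargeGaps]
* D. H. J. Polymath, *Variants of the Selberg sieve, and bounded intervals containing many primes*,
  Res. Math. Sci. 1 (2014), Lemma 4.1. [Polymath8b2014]
-/

noncomputable section

open Finset
open scoped BigOperators Classical

namespace Literature.NumberTheory.Sieve

namespace LcmEuler

variable {ι κ : Type*} [DecidableEq ι] [DecidableEq κ] [Fintype ι] [Fintype κ]

/-! ### The weighted coupled summand and local factor -/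

/-- The coupled summand with a general denominator weight `w`:
`(∏_i g_i(d_i) h_i(d'_i)) (∏_j g'_j(e_j) h'_j(e'_j)) · w(lcm(∏_i [d_i,d'_i], ∏_j [e_j,e'_j]))`.
[cite: Maynard2016LargeGaps, §6 displays (6.10) and (6.32)] -/
def coupledSummandW (g h : ι → ℕ → ℂ) (g' h' : κ → ℕ → ℂ) (w : ℕ → ℂ) (tD : (ι → ℕ) × (ι → ℕ))
    (tE : (κ → ℕ) × (κ → ℕ)) : ℂ :=
  ((∏ i, g i (tD.1 i) * h i (tD.2 i)) * ∏ j, g' j (tE.1 j) * h' j (tE.2 j)) *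
    w (Nat.lcm (∏ i, Nat.lcm (tD.1 i) (tD.2 i)) (∏ j, Nat.lcm (tE.1 j) (tE.2 j)))

/-- The weighted coupled Euler factor
`K^w_p = 1 + w(p) [ ∑_i A_i(p) + [p ∤ m] ( ∑_j B_j(p) + ∑_{(i,j) ∈ M p} A_i(p) B_j(p) ) ]`.
[cite: Maynard2016LargeGaps, §6 displays (6.11)–(6.13) and (6.32)] -/
def coupledLocalFactorW (g h : ι → ℕ → ℂ) (g' h' : κ → ℕ → ℂ) (w : ℕ → ℂ) (m : ℕ)
    (M : ℕ → Finset (ι × κ)) (q : ℕ) : ℂ :=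
  1 + w q * ((∑ i, slotTerm g h q i) +
      (if q ∣ m then 0 else
        (∑ j, slotTerm g' h' q j) + ∑ p ∈ M q, slotTerm g h q p.1 * slotTerm g' h' q p.2))

omit [DecidableEq ι] [DecidableEq κ] in
/-- `w(n) = 1/n` recovers `coupledSummand`. [cite: Maynard2016LargeGaps, §6 display (6.10)] -/
theorem coupledSummandW_inv (g h : ι → ℕ → ℂ) (g' h' : κ → ℕ → ℂ) (tD : (ι → ℕ) × (ι → ℕ))
    (tE : (κ → ℕ) × (κ → ℕ)) :
    coupledSummandW g h g' h' (fun n => (n : ℂ)⁻¹) tD tE = coupledSummand g h g' h' tD tE := by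
  rw [coupledSummandW, coupledSummand, div_eq_mul_inv]

omit [DecidableEq ι] [DecidableEq κ] in
/-- `w(n) = 1/n` recovers `coupledLocalFactor`. [cite: Maynard2016LargeGaps, §6 displays (6.11)–(6.13)] -/
theorem coupledLocalFactorW_inv (g h : ι → ℕ → ℂ) (g' h' : κ → ℕ → ℂ) (m : ℕ)
    (M : ℕ → Finset (ι × κ)) (q : ℕ) :
    coupledLocalFactorW g h g' h' (fun n => (n : ℂ)⁻¹) m M q = coupledLocalFactor g h g' h' m M q := by
  rw [coupledLocalFactorW, coupledLocalFactor, div_eq_mul_inv, mul_comm]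

/-! ### Numerator weights of colours -/

/-- The numerator weight of a colour at the prime `q`: `1`, `g_j(q)h_j(q)`, `g_j(q)`, `h_j(q)`.
[cite: Polymath8b2014, Lemma 4.1 (proof, (euler-fac))] -/
def numWeight (g h : ι → ℕ → ℂ) (q : ℕ) : Colour ι → ℂ
  | none => 1
  | some (j, t) => if t = 0 then g j q * h j q else if t = 1 then g j q else h j q

omit [DecidableEq ι] [Fintype ι] in
/-- `numWeight = colourWeightW` with the trivial weight. [folklore] -/
private theorem numWeight_eq (g h : ι → ℕ → ℂ) (q : ℕ) (o : Colour ι) :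
    numWeight g h q o = colourWeightW g h (fun _ => 1) q o := by
  rcases o with _ | ⟨j, t⟩
  · rfl
  · simp [numWeight, colourWeightW]

omit [DecidableEq ι] [Fintype ι] in
/-- `∑_a numWeight(i,a) · X = A_i(q) · X`. [folklore] -/
private theorem sum_numWeight_some_mul (g h : ι → ℕ → ℂ) (q : ℕ) (i : ι) (X : ℂ) :
    ∑ a : Fin 3, numWeight g h q (some (i, a)) * X = slotTerm g h q i * X := by
  rw [Fin.sum_univ_three]
  simp only [numWeight, Fin.isValue, if_true, show (1 : Fin 3) = 0 ↔ False by decide,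
    show (2 : Fin 3) = 0 ↔ False by decide, show (2 : Fin 3) = 1 ↔ False by decide, if_false,
    slotTerm]
  ring

/-- The weighted local weight of a pair of colours at the prime `q`:
`numWeight(d-colour) · numWeight(e-colour) · (w(q) if q is coloured on some side, else 1)`.
[cite: Maynard2016LargeGaps, §6 displays (6.11), (6.32)] -/
def coupledWeightW (g h : ι → ℕ → ℂ) (g' h' : κ → ℕ → ℂ) (w : ℕ → ℂ) (q : ℕ) (o : Colour ι)
    (o' : Colour κ) : ℂ :=
  numWeight g h q o * numWeight g' h' q o' * (if o ≠ none ∨ o' ≠ none then w q else 1)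

/-! ### Colourings: the lcm of the two sides -/

section Colour

variable {P : Finset ℕ} (hP : ∀ q ∈ P, q.Prime)
include hP

omit [DecidableEq κ] [Fintype κ] in
/-- `∏_i [d_i, d'_i]` of a colouring is the product of the coloured primes. [folklore] -/
private theorem prod_lcm_colour_eq' (c : ↥P → Colour ι) :
    ∏ i, Nat.lcm (colourFst P c i) (colourSnd P c i) =
      ∏ q ∈ Finset.univ.filter (fun q : ↥P => c q ≠ none), (q : ℕ) := by
  set S := Finset.univ.filter (fun q : ↥P => c q ≠ none) with hS
  have hfib : ∏ q ∈ S, (q : ℕ) =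
      ∏ o : Colour ι, ∏ q ∈ S.filter (fun q => c q = o), (q : ℕ) :=
    (Finset.prod_fiberwise_of_maps_to (g := c) (t := Finset.univ) (fun q _ => Finset.mem_univ _) _).symm
  rw [hfib, Fintype.prod_option]
  have hnone : S.filter (fun q => c q = none) = ∅ := by
    rw [Finset.filter_eq_empty_iff]
    intro q hq
    exact (Finset.mem_filter.1 hq).2
  rw [hnone, Finset.prod_empty, one_mul, Fintype.prod_prod_type]
  refine Finset.prod_congr rfl fun i _ => ?_
  rw [lcm_colourFst_colourSnd hP, Fin.prod_univ_three]
  have hfil : ∀ a : Fin 3, S.filter (fun q => c q = some (i, a)) =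
      Finset.univ.filter (fun q : ↥P => c q = some (i, a)) := by
    intro a
    ext q
    simp only [hS, Finset.mem_filter, Finset.mem_univ, true_and, ne_eq, and_iff_right_iff_imp]
    intro h
    rw [h]
    exact Option.some_ne_none _
  rw [hfil, hfil, hfil]
  rfl

omit [DecidableEq κ] [Fintype κ] [Fintype ι] [DecidableEq ι] in
/-- `gcd` of products of two sets of primes of `P` is the product over the intersection. [folklore] -/
private theorem gcd_prod_primes_eq' (S T : Finset ↥P) :
    Nat.gcd (∏ q ∈ S, (q : ℕ)) (∏ q ∈ T, (q : ℕ)) = ∏ q ∈ S ∩ T, (q : ℕ) := by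
  rw [← Finset.prod_inter_mul_prod_sdiff S T (fun q : ↥P => (q : ℕ)),
    ← Finset.prod_inter_mul_prod_sdiff T S (fun q : ↥P => (q : ℕ)), Finset.inter_comm T S,
    Nat.gcd_mul_left]
  have hcop : Nat.Coprime (∏ q ∈ S \ T, (q : ℕ)) (∏ q ∈ T \ S, (q : ℕ)) := by
    refine Nat.Coprime.prod_left fun q hq => Nat.Coprime.prod_right fun q' hq' => ?_
    have hne : (q : ℕ) ≠ q' := by
      intro heq
      have : q = q' := Subtype.ext heq
      rw [this] at hq
      exact (Finset.mem_sdiff.1 hq).2 (Finset.mem_sdiff.1 hq').1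
    exact (Nat.coprime_primes (prime_coe hP q) (prime_coe hP q')).2 hne
  rw [hcop.gcd_eq_one, mul_one]

omit [DecidableEq κ] [Fintype κ] [Fintype ι] [DecidableEq ι] in
/-- `lcm` of products of two sets of primes of `P` is the product over the union. [folklore] -/
private theorem lcm_prod_primes_eq (S T : Finset ↥P) :
    Nat.lcm (∏ q ∈ S, (q : ℕ)) (∏ q ∈ T, (q : ℕ)) = ∏ q ∈ S ∪ T, (q : ℕ) := by
  have h0 : (∏ q ∈ S ∩ T, (q : ℕ)) ≠ 0 :=
    Finset.prod_ne_zero_iff.2 fun q _ => (prime_coe hP q).ne_zero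
  have key := Nat.gcd_mul_lcm (∏ q ∈ S, (q : ℕ)) (∏ q ∈ T, (q : ℕ))
  rw [gcd_prod_primes_eq' hP, ← Finset.prod_union_inter, mul_comm (∏ q ∈ S ∪ T, (q : ℕ))] at key
  exact mul_left_cancel₀ h0 key

/-- `lcm(∏_i [d_i,d'_i], ∏_j [e_j,e'_j])` of a pair of colourings is the product of the primes coloured
on some side. [folklore] -/
private theorem lcm_prod_colour_eq (cD : ↥P → Colour ι) (cE : ↥P → Colour κ) :
    Nat.lcm (∏ i, Nat.lcm (colourFst P cD i) (colourSnd P cD i))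
        (∏ j, Nat.lcm (colourFst P cE j) (colourSnd P cE j)) =
      ∏ q ∈ Finset.univ.filter (fun q : ↥P => cD q ≠ none ∨ cE q ≠ none), (q : ℕ) := by
  rw [prod_lcm_colour_eq' hP cD, prod_lcm_colour_eq' hP cE, lcm_prod_primes_eq hP,
    Finset.filter_or]

/-! ### The summand of a pair of colourings -/

omit [DecidableEq κ] [Fintype κ] in
/-- The numerator product of a colouring is the product of the numerator weights. [folklore] -/
private theorem prod_num_colour (g h : ι → ℕ → ℂ) (hg : ∀ i, IsPrimeProdMult (g i))
    (hh : ∀ i, IsPrimeProdMult (h i)) (c : ↥P → Colour ι) :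
    ∏ i, g i (colourFst P c i) * h i (colourSnd P c i) = ∏ q : ↥P, numWeight g h q (c q) := by
  have hw1 : IsPrimeProdMult (fun _ : ℕ => (1 : ℂ)) := fun S _ => by simp
  have hc := pairSummandW_colour hP g h (fun _ => (1 : ℂ)) hg hh hw1 c
  simp only [pairSummandW, mul_one] at hc
  rw [hc]
  exact Finset.prod_congr rfl fun q _ => (numWeight_eq g h q (c q)).symm

/-- **The weighted coupled summand of a pair of colourings is the product over the primes of the
local weights.** [cite: Maynard2016LargeGaps, §6 (proof of Lemma 6, "the summand is also multiplicative"; Lemma 7, display (6.32))] -/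
theorem coupledSummandW_colour (g h : ι → ℕ → ℂ) (g' h' : κ → ℕ → ℂ)
    (hg : ∀ i, IsPrimeProdMult (g i)) (hh : ∀ i, IsPrimeProdMult (h i))
    (hg' : ∀ j, IsPrimeProdMult (g' j)) (hh' : ∀ j, IsPrimeProdMult (h' j))
    {w : ℕ → ℂ} (hw : IsPrimeProdMult w) (cD : ↥P → Colour ι) (cE : ↥P → Colour κ) :
    coupledSummandW g h g' h' w (colourFst P cD, colourSnd P cD) (colourFst P cE, colourSnd P cE) =
      ∏ q : ↥P, coupledWeightW g h g' h' w q (cD q) (cE q) := by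
  have hL : w (Nat.lcm (∏ i, Nat.lcm (colourFst P cD i) (colourSnd P cD i))
      (∏ j, Nat.lcm (colourFst P cE j) (colourSnd P cE j))) =
      ∏ q : ↥P, (if cD q ≠ none ∨ cE q ≠ none then w q else 1) := by
    rw [lcm_prod_colour_eq hP cD cE, hw.map_prod_coe hP, Finset.prod_filter]
  unfold coupledSummandW
  simp only
  rw [prod_num_colour hP g h hg hh cD, prod_num_colour hP g' h' hg' hh' cE, hL,
    ← Finset.prod_mul_distrib, ← Finset.prod_mul_distrib]
  rfl

/-! ### The local factor: the sum of the local weights over the allowed pairs of colours -/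

omit hP [DecidableEq ι] [DecidableEq κ] [Fintype ι] in
/-- Row `none` of the local sum: `1 + [q ∤ m] w(q) ∑_j B_j(q)`. [folklore] -/
private theorem sum_allowed_noneW (g h : ι → ℕ → ℂ) (g' h' : κ → ℕ → ℂ) (w : ℕ → ℂ) (m : ℕ)
    (M : ℕ → Finset (ι × κ)) (q : ℕ) :
    ∑ o' : Colour κ, (if AllowedAt m M q (none : Colour ι) o' then
        coupledWeightW g h g' h' w q none o' else 0) =
      1 + (if q ∣ m then 0 else w q * ∑ j, slotTerm g' h' q j) := by
  rw [Fintype.sum_option]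
  have h0 : (if AllowedAt m M q (none : Colour ι) (none : Colour κ) then
      coupledWeightW g h g' h' w q none none else 0) = 1 := by
    simp [AllowedAt, coupledWeightW, numWeight]
  rw [h0]
  congr 1
  have h1 : ∀ o : κ × Fin 3, (if AllowedAt m M q (none : Colour ι) (some o) then
      coupledWeightW g h g' h' w q none (some o) else 0) =
      if q ∣ m then 0 else numWeight g' h' q (some o) * w q := by
    rintro ⟨j, b⟩
    by_cases hm : q ∣ m <;> simp [AllowedAt, coupledWeightW, numWeight, hm]
  simp_rw [h1]
  by_cases hm : q ∣ m
  · simp [hm]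
  · simp only [hm, if_false]
    rw [Fintype.sum_prod_type, Finset.mul_sum]
    refine Finset.sum_congr rfl fun j _ => ?_
    rw [sum_numWeight_some_mul g' h' q j, mul_comm]

omit hP [Fintype ι] in
/-- Row `some (i, a)` of the local sum:
`numWeight(i,a) · w(q) · (1 + [q ∤ m] ∑_{j : (i,j) ∈ M q} B_j(q))`. [folklore] -/
private theorem sum_allowed_someW (g h : ι → ℕ → ℂ) (g' h' : κ → ℕ → ℂ) (w : ℕ → ℂ) (m : ℕ)
    (M : ℕ → Finset (ι × κ)) (q : ℕ) (i : ι) (a : Fin 3) :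
    ∑ o' : Colour κ, (if AllowedAt m M q (some (i, a)) o' then
        coupledWeightW g h g' h' w q (some (i, a)) o' else 0) =
      numWeight g h q (some (i, a)) *
        (w q * (1 + if q ∣ m then 0 else ∑ j, if (i, j) ∈ M q then slotTerm g' h' q j else 0)) := by
  rw [Fintype.sum_option]
  have h0 : (if AllowedAt m M q (some (i, a)) (none : Colour κ) then
      coupledWeightW g h g' h' w q (some (i, a)) none else 0) =
      numWeight g h q (some (i, a)) * w q := by
    simp [AllowedAt, coupledWeightW, numWeight]
  rw [h0, mul_add, mul_one, mul_add]
  congr 1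
  have h1 : ∀ o : κ × Fin 3, (if AllowedAt m M q (some (i, a)) (some o) then
      coupledWeightW g h g' h' w q (some (i, a)) (some o) else 0) =
      if q ∣ m then 0 else
        if (i, o.1) ∈ M q then numWeight g h q (some (i, a)) * (numWeight g' h' q (some o) * w q)
        else 0 := by
    rintro ⟨j, b⟩
    by_cases hm : q ∣ m
    · simp [AllowedAt, hm]
    · by_cases hM : (i, j) ∈ M q
      · simp [AllowedAt, coupledWeightW, hm, hM, mul_assoc]
      · simp [AllowedAt, hm, hM]
  simp_rw [h1]
  by_cases hm : q ∣ m
  · simp [hm]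
  · simp only [hm, if_false]
    rw [Fintype.sum_prod_type, Finset.mul_sum, Finset.mul_sum]
    refine Finset.sum_congr rfl fun j _ => ?_
    by_cases hM : (i, j) ∈ M q
    · simp only [hM, if_true]
      rw [← Finset.mul_sum, sum_numWeight_some_mul g' h' q j]
      ring
    · simp [hM]

omit hP in
/-- **The weighted local sum in closed form**: `∑_{allowed (o,o')} coupledWeightW q o o' = K^w_q`.
[cite: Maynard2016LargeGaps, §6 displays (6.11)–(6.13), (6.32)] -/
theorem sum_allowed_coupledWeightW_eq (g h : ι → ℕ → ℂ) (g' h' : κ → ℕ → ℂ) (w : ℕ → ℂ) (m : ℕ)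
    (M : ℕ → Finset (ι × κ)) (q : ℕ) :
    ∑ o ∈ Finset.univ.filter (fun o : Colour ι × Colour κ => AllowedAt m M q o.1 o.2),
        coupledWeightW g h g' h' w q o.1 o.2 = coupledLocalFactorW g h g' h' w m M q := by
  rw [Finset.sum_filter, Fintype.sum_prod_type, Fintype.sum_option, sum_allowed_noneW g h g' h' w m M q]
  simp_rw [Fintype.sum_prod_type, sum_allowed_someW g h g' h' w m M q]
  simp_rw [sum_numWeight_some_mul g h q]
  -- the `M`-sum as an iterated sum
  have hM : ∑ p ∈ M q, slotTerm g h q p.1 * slotTerm g' h' q p.2 =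
      ∑ i, slotTerm g h q i * ∑ j, if (i, j) ∈ M q then slotTerm g' h' q j else 0 := by
    have : ∑ p ∈ M q, slotTerm g h q p.1 * slotTerm g' h' q p.2 =
        ∑ p : ι × κ, if p ∈ M q then slotTerm g h q p.1 * slotTerm g' h' q p.2 else 0 := by
      rw [← Finset.sum_filter, Finset.filter_mem_eq_inter, Finset.univ_inter]
    rw [this, Fintype.sum_prod_type]
    refine Finset.sum_congr rfl fun i _ => ?_
    rw [Finset.mul_sum]
    refine Finset.sum_congr rfl fun j _ => ?_
    split_ifs <;> simp
  rw [coupledLocalFactorW, hM]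
  by_cases hm : q ∣ m
  · simp only [hm, if_true, add_zero, mul_one]
    rw [Finset.mul_sum]
    refine congrArg _ (Finset.sum_congr rfl fun i _ => by ring)
  · simp only [hm, if_false]
    have hsplit : ∑ i, slotTerm g h q i *
        (w q * (1 + ∑ j, if (i, j) ∈ M q then slotTerm g' h' q j else 0)) =
        w q * ∑ i, slotTerm g h q i +
          w q * ∑ i, slotTerm g h q i * (∑ j, if (i, j) ∈ M q then slotTerm g' h' q j else 0) := by
      rw [Finset.mul_sum, Finset.mul_sum, ← Finset.sum_add_distrib]
      refine Finset.sum_congr rfl fun i _ => ?_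
      ring
    rw [hsplit]
    ring

/-! ### The weighted coupled Euler product -/

/-- **The coupled Euler product with a general multiplicative weight** (Maynard's (6.10) = `∏_p K_p`
for `w = 1/n`, and the main term (6.32) of Lemma 7 for `w = 1/φ`): for a finite set of primes `P`,
numerators multiplicative over products of distinct primes, a weight `w` multiplicative over products
of distinct primes, any `m` and any coupling datum `M`,
`∑_{(d,d') adm.} ∑_{(e,e') adm.} [CrossCond] coupledSummandW = ∏_{p ∈ P} coupledLocalFactorW p`.
[cite: Maynard2016LargeGaps, §6 displays (6.10)–(6.13) and (6.32)] -/
theorem sum_coupledW_eq_prod (g h : ι → ℕ → ℂ) (g' h' : κ → ℕ → ℂ)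
    (hg : ∀ i, IsPrimeProdMult (g i)) (hh : ∀ i, IsPrimeProdMult (h i))
    (hg' : ∀ j, IsPrimeProdMult (g' j)) (hh' : ∀ j, IsPrimeProdMult (h' j))
    {w : ℕ → ℂ} (hw : IsPrimeProdMult w) (m : ℕ) (M : ℕ → Finset (ι × κ)) :
    ∑ tD ∈ (pairBox ι P).filter PairwiseCoprimeLcm, ∑ tE ∈ (pairBox κ P).filter PairwiseCoprimeLcm,
        (if CrossCond P m M tD tE then coupledSummandW g h g' h' w tD tE else 0) =
      ∏ q ∈ P, coupledLocalFactorW g h g' h' w m M q := by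
  rw [sum_filter_pairBox_eq_sum_colour hP]
  simp_rw [sum_filter_pairBox_eq_sum_colour hP]
  have h1 : ∀ (cD : ↥P → Colour ι) (cE : ↥P → Colour κ),
      (if CrossCond P m M (colourFst P cD, colourSnd P cD) (colourFst P cE, colourSnd P cE) then
        coupledSummandW g h g' h' w (colourFst P cD, colourSnd P cD) (colourFst P cE, colourSnd P cE)
        else 0) =
      if ∀ q : ↥P, AllowedAt m M q (cD q) (cE q) then
        ∏ q : ↥P, coupledWeightW g h g' h' w q (cD q) (cE q) else 0 := fun cD cE =>
    if_congr (crossCond_colour_iff hP m M cD cE)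
      (coupledSummandW_colour hP g h g' h' hg hh hg' hh' hw cD cE) rfl
  simp_rw [h1]
  -- one colouring with values in `Colour ι × Colour κ`
  rw [← Fintype.sum_prod_type',
    ← (Equiv.arrowProdEquivProdArrow ↥P (fun _ => Colour ι) (fun _ => Colour κ)).sum_comp]
  simp only [Equiv.arrowProdEquivProdArrow_apply]
  rw [← Finset.sum_filter]
  have hset : Finset.univ.filter
      (fun c : ↥P → Colour ι × Colour κ => ∀ q : ↥P, AllowedAt m M (q : ℕ) (c q).1 (c q).2) =
      Fintype.piFinset (fun q : ↥P =>
        Finset.univ.filter (fun o : Colour ι × Colour κ => AllowedAt m M q o.1 o.2)) := by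
    ext c
    simp [Fintype.mem_piFinset]
  rw [hset, ← Finset.prod_univ_sum (fun q : ↥P =>
      Finset.univ.filter (fun o : Colour ι × Colour κ => AllowedAt m M q o.1 o.2))
    (fun q o => coupledWeightW g h g' h' w q o.1 o.2), ← Finset.prod_coe_sort P]
  exact Finset.prod_congr rfl fun q _ => sum_allowed_coupledWeightW_eq g h g' h' w m M q

end Colour

end LcmEuler

end Literature.NumberTheory.Sieve

end
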